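import Summits.QuantumAdvantage.QuantumAdvantage.Theorems.RandomOracleGaugeDecoupledCoreAAL1FamilyExpRung
import Literature.Computability.QuantumComplexity.InfluenceBounds
import HarnessLib

/-!
# Crux `DecoupledCoreAA` (stmt-QuantumAdvantage-17872), line `l1-family`, stub `stub_l1Family` —
# the POINCARÉ-SCALE rung: the dichotomy holds with `1/N` on the coordinate side (no degree hypothesis)

`stub_l1Family` (`Cruxes/AAConj/Lines/l1_family.lean`) asks, for an ℓ¹-bounded family `g_1..g_N` of degree-`≤ d` cube
polynomials with total mass `V = Σ_i E[g_i²] ≥ 1/(K₀ d^κ₀)`, for a member of mass `≥ C/d^c` OR a coordinate of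
aggregate influence `≥ C/d^c` — uniformly in the number of variables `N`.  This file lands the `N`-DEPENDENT baseline,
which needs NO degree hypothesis at all (Poincaré only):

* §1 `abs_boolAvg_le_sqrt` (`|E g| ≤ √E[g²]`), `sum_sq_boolAvg_le` (`Σ_i (E g_i)² ≤ √(max mass)·L` for
  `Σ_i |g_i| ≤ L` pointwise, with `…L1FamilyExpRung.sum_boolAvg_abs_le`), `four_mul_sq_sub_le_sum_influence` (Poincaré `4(E[p²] − (E p)²) ≤ Σ_i Inf_i` from the tree's
  Walsh identities), `sum_sum_influence_ge` (`Σ_j Σ_i Inf_j[g_i] ≥ 4(V − Σ_i (E g_i)²)`, Poincaré summed over the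
  family).
* §2 `exists_heavyCoordinate_of_light` — if every member is light (`E[g_i²] ≤ τ`) then some coordinate has
  aggregate influence `≥ 4(V − √τ·L)/N`.
* §3 `l1Family_poincareScale` — in the stub's regime (`L = 1`, `v := 1/(K₀ d^κ₀) ≤ V`):
  `(∃ i, E[g_i²] ≥ v²/4) ∨ (∃ j, Σ_i E[(g_i − g_i^{⊕j})²] ≥ 2v/N)`; `l1Family_of_card_le` — hence the registered
  statement restricted to `N ≤ M₀·d^{μ₀}` (polynomially many variables/members) holds for every `(M₀, μ₀)`.

With the companions (`…L1FamilyExpRung`: alternative (A) alone at scale `9^{-d}`; `…L1FamilyAddress`: neither alternative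
can be dropped; `…L1FamilyEquiv`: stub ⟺ crux ⟺ `AAConj`) this pins the stub's content to exactly the Aaronson–Ambainis
phenomenon: remove the `1/N` (equivalently the `9^{-d}`) at polynomial cost in `d`.  Honest label: calibration; no stub,
crux or summit is closed.  Sources: O'Donnell 2014 §2.3 (Poincaré); O'Donnell–Zhao arXiv:1512.01603 eqn. (2.1);
Aaronson–Ambainis arXiv:0911.0996 Conj. 6.
-/

-- D-0017: single-conjunct summit ⇒ the duplicate `QuantumAdvantage.QuantumAdvantage` is mandated.
set_option linter.dupNamespace false

noncomputable section

open Finset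
open Literature.Computability.QuantumComplexity
open Literature.Computability.Complexity.LowDegree (cubeFourierCoeff sum_cubeFourierCoeff_sq)
open Summit.QuantumAdvantage.QuantumAdvantage.Cruxes.DecoupledCoreAA.L1Family.ExpRung (sum_boolAvg_abs_le)

namespace Summit.QuantumAdvantage.QuantumAdvantage.Cruxes.DecoupledCoreAA.L1Family.Poincare

variable {N : ℕ}

/-! ### §1 Means against masses; Poincaré summed over the family -/

/-- **Poincaré inequality**, second-moment form: `4·(E[p²] − (E p)²) ≤ Σ_i Inf_i[p]`
(`Σ_i Inf_i = 4 Σ_S |S| p̂(S)²` by the tree's `sum_influence_eq`; Parseval `Σ_S p̂(S)² = E[p²]`; `p̂(∅) = E p`).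
The tree's `FHKL.four_mul_boolVariance_le_sum_influence` is the same inequality with `Var` on the left (its module is
farm-stale at submission time, hence this second-moment spelling). [cite: ODonnell2014, §2.3] -/
theorem four_mul_sq_sub_le_sum_influence (p : MvPolynomial (Fin N) ℝ) :
    4 * (boolAvg (fun z => evalBool p z ^ 2) - boolAvg (evalBool p) ^ 2) ≤ ∑ i, influence i p := by
  classical
  have hpar : boolAvg (fun z => evalBool p z ^ 2) = ∑ S, cubeFourierCoeff (evalBool p) S ^ 2 := by
    rw [sum_cubeFourierCoeff_sq]; rfl
  rw [sum_influence_eq, hpar, boolAvg_evalBool_eq_fourier_empty]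
  have hsplit : ∑ S, cubeFourierCoeff (evalBool p) S ^ 2 - cubeFourierCoeff (evalBool p) ∅ ^ 2 =
      ∑ S : Finset (Fin N), (cubeFourierCoeff (evalBool p) S ^ 2 -
        if S = ∅ then cubeFourierCoeff (evalBool p) S ^ 2 else 0) := by
    rw [Finset.sum_sub_distrib, Finset.sum_ite_eq' Finset.univ (∅ : Finset (Fin N)), if_pos (Finset.mem_univ _)]
  rw [hsplit, Finset.mul_sum, Finset.mul_sum]
  refine Finset.sum_le_sum fun S _ => ?_
  by_cases hS : S = ∅
  · subst hS
    simp
  · rw [if_neg hS, sub_zero]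
    have h1 : (1 : ℝ) ≤ (S.card : ℝ) := by
      exact_mod_cast Finset.one_le_card.mpr (Finset.nonempty_iff_ne_empty.mpr hS)
    nlinarith [sq_nonneg (cubeFourierCoeff (evalBool p) S)]

/-- `Var[g] = E[g²] − (E g)²` in the tree's vocabulary. [cite: ODonnell2014, §2.3] -/
theorem boolVariance_eq_sq_sub (p : MvPolynomial (Fin N) ℝ) :
    boolVariance p = boolAvg (fun z => evalBool p z ^ 2) - boolAvg (evalBool p) ^ 2 := by
  unfold boolVariance boolAvg
  set m := (∑ x, evalBool p x) / (2 : ℝ) ^ N with hm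
  have h2N : (0 : ℝ) < (2 : ℝ) ^ N := by positivity
  have hcard : ∑ _x : Fin N → Bool, (1 : ℝ) = (2 : ℝ) ^ N := by
    simp [Finset.card_univ, Fintype.card_bool, Fintype.card_fin]
  have hexp : ∀ x, (evalBool p x - m) ^ 2 = evalBool p x ^ 2 - 2 * m * evalBool p x + m ^ 2 * 1 := by
    intro x; ring
  simp_rw [hexp]
  rw [Finset.sum_add_distrib, Finset.sum_sub_distrib, ← Finset.mul_sum, ← Finset.mul_sum, hcard]
  have hsum : ∑ x, evalBool p x = m * (2 : ℝ) ^ N := by rw [hm]; field_simp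
  rw [hsum]
  field_simp
  ring

/-- `(E g)² ≤ E[g²]` (the variance is nonnegative). [cite: ODonnell2014, §2.3] -/
theorem boolAvg_sq_le (p : MvPolynomial (Fin N) ℝ) :
    boolAvg (evalBool p) ^ 2 ≤ boolAvg (fun z => evalBool p z ^ 2) := by
  have h := boolVariance_nonneg p
  rw [boolVariance_eq_sq_sub] at h
  linarith

/-- `|E g| ≤ √(E[g²])`. [cite: ODonnell2014, §2.3] -/
theorem abs_boolAvg_le_sqrt (p : MvPolynomial (Fin N) ℝ) :
    |boolAvg (evalBool p)| ≤ Real.sqrt (boolAvg fun z => evalBool p z ^ 2) := by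
  rw [← Real.sqrt_sq_eq_abs]
  exact Real.sqrt_le_sqrt (boolAvg_sq_le p)

/-- `|E g| ≤ E|g|`. [folklore] -/
theorem abs_boolAvg_le_boolAvg_abs (f : (Fin N → Bool) → ℝ) :
    |boolAvg f| ≤ boolAvg fun z => |f z| := by
  unfold boolAvg
  rw [abs_div, abs_of_pos (by positivity : (0 : ℝ) < (2 : ℝ) ^ N)]
  exact div_le_div_of_nonneg_right (Finset.abs_sum_le_sum_abs _ _) (by positivity)

/-- **Squared means are controlled by the largest mass**: if `Σ_i |g_i(z)| ≤ L` pointwise and every mass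
`E[g_i²] ≤ τ`, then `Σ_i (E g_i)² ≤ √τ · L` (`(E g_i)² ≤ |E g_i|·√(E g_i²) ≤ √τ · E|g_i|`). [folklore] -/
theorem sum_sq_boolAvg_le {ι : Type*} [Fintype ι] (g : ι → MvPolynomial (Fin N) ℝ) {L τ : ℝ}
    (hl1 : ∀ z, ∑ i, |evalBool (g i) z| ≤ L) (hτ : ∀ i, boolAvg (fun z => evalBool (g i) z ^ 2) ≤ τ) :
    ∑ i, boolAvg (evalBool (g i)) ^ 2 ≤ Real.sqrt τ * L := by
  have hterm : ∀ i, boolAvg (evalBool (g i)) ^ 2 ≤ Real.sqrt τ * boolAvg (fun z => |evalBool (g i) z|) := by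
    intro i
    have h1 : |boolAvg (evalBool (g i))| ≤ Real.sqrt τ :=
      (abs_boolAvg_le_sqrt (g i)).trans (Real.sqrt_le_sqrt (hτ i))
    have h2 : |boolAvg (evalBool (g i))| ≤ boolAvg fun z => |evalBool (g i) z| := abs_boolAvg_le_boolAvg_abs _
    calc boolAvg (evalBool (g i)) ^ 2 = |boolAvg (evalBool (g i))| * |boolAvg (evalBool (g i))| := by
          rw [← sq, sq_abs]
      _ ≤ Real.sqrt τ * boolAvg fun z => |evalBool (g i) z| :=
          mul_le_mul h1 h2 (abs_nonneg _) (Real.sqrt_nonneg _)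
  calc ∑ i, boolAvg (evalBool (g i)) ^ 2 ≤ ∑ i, Real.sqrt τ * boolAvg (fun z => |evalBool (g i) z|) :=
        Finset.sum_le_sum fun i _ => hterm i
    _ = Real.sqrt τ * ∑ i, boolAvg (fun z => |evalBool (g i) z|) := by rw [Finset.mul_sum]
    _ ≤ Real.sqrt τ * L := mul_le_mul_of_nonneg_left (sum_boolAvg_abs_le g hl1) (Real.sqrt_nonneg _)

/-- **Poincaré summed over the family**: `Σ_j Σ_i Inf_j[g_i] ≥ 4(V − Σ_i (E g_i)²)`, `V = Σ_i E[g_i²]`.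
[cite: ODonnell2014, §2.3] -/
theorem sum_sum_influence_ge {ι : Type*} [Fintype ι] (g : ι → MvPolynomial (Fin N) ℝ) :
    4 * (∑ i, boolAvg (fun z => evalBool (g i) z ^ 2) - ∑ i, boolAvg (evalBool (g i)) ^ 2) ≤
      ∑ j : Fin N, ∑ i, influence j (g i) := by
  rw [Finset.sum_comm, ← Finset.sum_sub_distrib, Finset.mul_sum]
  exact Finset.sum_le_sum fun i _ => four_mul_sq_sub_le_sum_influence (g i)

/-! ### §2 Light members force a heavy coordinate — at scale `1/N` -/

/-- **Light members ⟹ a coordinate of aggregate influence `≥ 4(V − √τ·L)/N`.**  For a family with `Σ_i |g_i(z)| ≤ L`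
pointwise and all masses `≤ τ`, on `N ≥ 1` variables: some coordinate `j` has
`Σ_i E[(g_i − g_i^{⊕j})²] ≥ 4(V − √τ L)/N`.  No degree hypothesis. [cite: ODonnell2014, §2.3] -/
theorem exists_heavyCoordinate_of_light {ι : Type*} [Fintype ι] (g : ι → MvPolynomial (Fin N) ℝ) {L τ : ℝ}
    (hN : 0 < N) (hl1 : ∀ z, ∑ i, |evalBool (g i) z| ≤ L)
    (hτ : ∀ i, boolAvg (fun z => evalBool (g i) z ^ 2) ≤ τ) :
    ∃ j : Fin N, 4 * (∑ i, boolAvg (fun z => evalBool (g i) z ^ 2) - Real.sqrt τ * L) / N ≤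
      ∑ i, boolAvg (fun z => (evalBool (g i) z - evalBool (g i) (flipBit j z)) ^ 2) := by
  classical
  set F : Fin N → ℝ := fun j => ∑ i, boolAvg (fun z => (evalBool (g i) z - evalBool (g i) (flipBit j z)) ^ 2)
    with hF
  have hFinf : ∀ j, F j = ∑ i, influence j (g i) := fun j => rfl
  have hne : (Finset.univ : Finset (Fin N)).Nonempty := Finset.univ_nonempty_iff.mpr ⟨⟨0, hN⟩⟩
  obtain ⟨j₀, -, hj₀⟩ := Finset.exists_max_image Finset.univ F hne
  refine ⟨j₀, ?_⟩
  have htot : 4 * (∑ i, boolAvg (fun z => evalBool (g i) z ^ 2) - Real.sqrt τ * L) ≤ ∑ j, F j := by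
    calc 4 * (∑ i, boolAvg (fun z => evalBool (g i) z ^ 2) - Real.sqrt τ * L)
        ≤ 4 * (∑ i, boolAvg (fun z => evalBool (g i) z ^ 2) - ∑ i, boolAvg (evalBool (g i)) ^ 2) := by
          linarith [sum_sq_boolAvg_le g hl1 hτ]
      _ ≤ ∑ j : Fin N, ∑ i, influence j (g i) := sum_sum_influence_ge g
      _ = ∑ j, F j := Finset.sum_congr rfl fun j _ => (hFinf j).symm
  have hmax : ∑ j, F j ≤ (N : ℝ) * F j₀ := by
    calc ∑ j, F j ≤ ∑ _j : Fin N, F j₀ := Finset.sum_le_sum fun j _ => hj₀ j (Finset.mem_univ _)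
      _ = (N : ℝ) * F j₀ := by simp [Finset.sum_const, Finset.card_univ, Fintype.card_fin]
  have hN0 : (0 : ℝ) < (N : ℝ) := by exact_mod_cast hN
  rw [div_le_iff₀ hN0]
  linarith [mul_comm (F j₀) (N : ℝ)]

/-! ### §3 The stub's regime: the dichotomy at Poincaré scale, and for polynomially many variables -/

/-- **`stub_l1Family` at Poincaré scale.**  In the stub's regime `v := 1/(K₀ d^κ₀) ≤ V` (family
`g : Fin N → ℝ[x_1..x_N]`, `Σ_i |g_i(z)| ≤ 1` pointwise; the degree bound is NOT used):
`(∃ i, E[g_i²] ≥ v²/4) ∨ (∃ j, Σ_i E[(g_i − g_i^{⊕j})²] ≥ 2v/N)` — if every mass is `< v²/4` then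
`Σ_i (E g_i)² ≤ v/2 ≤ V/2`, total influence `≥ 2V ≥ 2v`, pigeonhole over `N` coordinates.  The stub asks for the `N`
to disappear at polynomial cost in `d`. [cite: ODonnellZhao2016, eqn. (2.1)] [cite: ODonnell2014, §2.3] -/
theorem l1Family_poincareScale (κ₀ : ℕ) {K₀ : ℝ} (hK₀ : 0 < K₀) {N d : ℕ}
    (g : Fin N → MvPolynomial (Fin N) ℝ) (hd : 1 ≤ d) (hl1 : ∀ z, ∑ i, |evalBool (g i) z| ≤ 1)
    (hreg : 1 ≤ K₀ * (d : ℝ) ^ κ₀ * ∑ i, boolAvg (fun z => evalBool (g i) z ^ 2)) :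
    (∃ i, (1 / (K₀ * (d : ℝ) ^ κ₀)) ^ 2 / 4 ≤ boolAvg (fun z => evalBool (g i) z ^ 2)) ∨
    (∃ j, 2 * (1 / (K₀ * (d : ℝ) ^ κ₀)) / N ≤
      ∑ i, boolAvg (fun z => (evalBool (g i) z - evalBool (g i) (flipBit j z)) ^ 2)) := by
  set V := ∑ i, boolAvg (fun z => evalBool (g i) z ^ 2) with hVdef
  set v := 1 / (K₀ * (d : ℝ) ^ κ₀) with hvdef
  have hd0 : (0 : ℝ) < (d : ℝ) := by exact_mod_cast hd
  have hKd : 0 < K₀ * (d : ℝ) ^ κ₀ := by positivity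
  have hvpos : 0 < v := by positivity
  have hVge : v ≤ V := by
    rw [hvdef, div_le_iff₀ hKd]
    linarith [hreg, mul_comm (K₀ * (d : ℝ) ^ κ₀) V]
  by_cases hA : ∃ i, v ^ 2 / 4 ≤ boolAvg (fun z => evalBool (g i) z ^ 2)
  · exact Or.inl hA
  right
  push Not at hA
  -- `N ≥ 1`: otherwise `V = 0 < v`
  have hN : 0 < N := by
    rcases Nat.eq_zero_or_pos N with h0 | hpos
    · exfalso
      subst h0
      have : V = 0 := by rw [hVdef]; simp
      linarith
    · exact hpos
  have hτ : ∀ i, boolAvg (fun z => evalBool (g i) z ^ 2) ≤ v ^ 2 / 4 := fun i => (hA i).le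
  obtain ⟨j, hj⟩ := exists_heavyCoordinate_of_light g hN hl1 hτ
  refine ⟨j, le_trans ?_ hj⟩
  have hsqrt : Real.sqrt (v ^ 2 / 4) = v / 2 := by
    rw [show v ^ 2 / 4 = (v / 2) ^ 2 by ring, Real.sqrt_sq (by positivity)]
  rw [hsqrt, mul_one]
  have hN0 : (0 : ℝ) < (N : ℝ) := by exact_mod_cast hN
  apply div_le_div_of_nonneg_right _ hN0.le
  linarith

/-- **`stub_l1Family` restricted to polynomially many variables holds, for EVERY polynomial cap.**  The registered
statement with the extra hypothesis `N ≤ M₀ d^{μ₀}`, witnessed by `(c, C) := (2κ₀ + μ₀, min (1/(4K₀²)) (2/(K₀ M₀)))`.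
So, like the `9^{-d}` of `…L1FamilyExpRung`, the `1/N` is exactly what the open stub must remove.
[cite: ODonnellZhao2016, eqn. (2.1) and Thm. 2.13] [cite: ODonnell2014, §2.3] -/
theorem l1Family_of_card_le (M₀ : ℝ) (hM₀ : 0 < M₀) (μ₀ : ℕ) :
    ∀ (κ₀ : ℕ) (K₀ : ℝ), 0 < K₀ → ∃ (c : ℕ) (C : ℝ), 0 < C ∧
      ∀ (N d : ℕ) (g : Fin N → MvPolynomial (Fin N) ℝ), (N : ℝ) ≤ M₀ * (d : ℝ) ^ μ₀ → 1 ≤ d →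
        (∀ i, (g i).totalDegree ≤ d) →
        (∀ z, ∑ i, |evalBool (g i) z| ≤ 1) →
        1 ≤ K₀ * (d : ℝ) ^ κ₀ * ∑ i, boolAvg (fun z => evalBool (g i) z ^ 2) →
        (∃ i, C / (d : ℝ) ^ c ≤ boolAvg (fun z => evalBool (g i) z ^ 2)) ∨
        (∃ j, C / (d : ℝ) ^ c ≤
          ∑ i, boolAvg (fun z => (evalBool (g i) z - evalBool (g i) (flipBit j z)) ^ 2)) := by
  intro κ₀ K₀ hK₀
  refine ⟨2 * κ₀ + μ₀, min (1 / (4 * K₀ ^ 2)) (2 / (K₀ * M₀)), lt_min (by positivity) (by positivity), ?_⟩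
  intro N d g hNle hd _hdeg hl1 hreg
  have hd0 : (0 : ℝ) < (d : ℝ) := by exact_mod_cast hd
  have hd1 : (1 : ℝ) ≤ (d : ℝ) := by exact_mod_cast hd
  rcases l1Family_poincareScale κ₀ hK₀ g hd hl1 hreg with ⟨i, hi⟩ | ⟨j, hj⟩
  · left
    refine ⟨i, le_trans ?_ hi⟩
    -- `min(…)/d^{2κ₀+μ₀} ≤ (1/(4K₀²))/d^{2κ₀} = (1/(K₀ d^κ₀))²/4`
    have hdpow : (d : ℝ) ^ (2 * κ₀) ≤ (d : ℝ) ^ (2 * κ₀ + μ₀) := pow_le_pow_right₀ hd1 (by omega)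
    calc min (1 / (4 * K₀ ^ 2)) (2 / (K₀ * M₀)) / (d : ℝ) ^ (2 * κ₀ + μ₀)
        ≤ (1 / (4 * K₀ ^ 2)) / (d : ℝ) ^ (2 * κ₀ + μ₀) :=
          div_le_div_of_nonneg_right (min_le_left _ _) (by positivity)
      _ ≤ (1 / (4 * K₀ ^ 2)) / (d : ℝ) ^ (2 * κ₀) :=
          div_le_div_of_nonneg_left (by positivity) (by positivity) hdpow
      _ = (1 / (K₀ * (d : ℝ) ^ κ₀)) ^ 2 / 4 := by
          rw [pow_mul, div_pow, mul_pow, one_pow, ← pow_mul, ← pow_mul, mul_comm κ₀ 2]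
          field_simp
  · right
    refine ⟨j, le_trans ?_ hj⟩
    -- `N ≥ 1` here (the sum over `Fin N` in `hj`'s bound is irrelevant; use the cap on `N`)
    rcases (Nat.cast_nonneg N : (0 : ℝ) ≤ N).eq_or_lt with hz | hNpos
    · -- `N = 0`: the right-hand side `2v/0 = 0`; the left side must be shown `≤ 0`?  No: then `hj` reads `0 ≤ …`
      -- and we bound the constant by `2v/N` only for `N > 0`; for `N = 0` the regime is impossible.
      exfalso
      have hN : N = 0 := by exact_mod_cast hz.symm
      subst hN
      have : ∑ i : Fin 0, boolAvg (fun z => evalBool (g i) z ^ 2) = 0 := by simp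
      rw [this, mul_zero] at hreg
      linarith
    · have hKd : 0 < K₀ * (d : ℝ) ^ κ₀ := by positivity
      calc min (1 / (4 * K₀ ^ 2)) (2 / (K₀ * M₀)) / (d : ℝ) ^ (2 * κ₀ + μ₀)
          ≤ (2 / (K₀ * M₀)) / (d : ℝ) ^ (2 * κ₀ + μ₀) :=
            div_le_div_of_nonneg_right (min_le_right _ _) (by positivity)
        _ ≤ (2 / (K₀ * M₀)) / (d : ℝ) ^ (κ₀ + μ₀) :=
            div_le_div_of_nonneg_left (by positivity) (by positivity) (pow_le_pow_right₀ hd1 (by omega))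
        _ = 2 * (1 / (K₀ * (d : ℝ) ^ κ₀)) / (M₀ * (d : ℝ) ^ μ₀) := by
            rw [pow_add]
            field_simp
        _ ≤ 2 * (1 / (K₀ * (d : ℝ) ^ κ₀)) / N :=
            div_le_div_of_nonneg_left (by positivity) hNpos hNle

end Summit.QuantumAdvantage.QuantumAdvantage.Cruxes.DecoupledCoreAA.L1Family.Poincare

end
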